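/-
b2b-lace packet, LEAN TYPING SEAT 2 gen 16 (unit `b2b-lace-lean2-g16`).  (S2b)-IMPR node ASM-a (HOME/LEMMAS; owner lean2): measurability of the
atoms `lapAtomsAt` and INTEGRABILITY on the cube of the five signed piece integrands `Ĥ_i Ĝⁿ D̂^l D̂^{(x)}` of [NoBLE17] (3.58) — the displayed
binders `hI1`–`hI5` of `NobleWeightedDiagramAssembly.abs_nobleH_le_boundHD75_of_pieces` (p193098), discharged.  d-generic; no numeral, no dimension,
no named fact; NEW module, nothing existing is touched.
-/
import Literature.Probability.FitznerVanDerHofstad2017.NobleH4StepD75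
import HarnessLib

/-!
# Literature.Probability.FitznerVanDerHofstad2017.NobleLapAtomsIntegrable — the piece integrands of [NoBLE17] (3.58) are integrable

[NoBLE17] = R. Fitzner, R. van der Hofstad, *Generalized approach to the non-backtracking lace expansion*, PTRF 169 (2017) 1041–1119.

(3.59) `ℋ^{n,l}_z(x) = Σ_{i=1}^5 ℋ^{n,l}_{i,z}(x)` is LINEARITY of `∫_{[−π,π]^d} · dk` over the split `−ΔĜ_z = Σ_i Ĥ_i` ((3.57)); in the kernel it
needs each signed piece `k ↦ Ĥ_i(k) Ĝ_z(k)ⁿ D̂(k)^l D̂^{(x)}(k)` to be INTEGRABLE for the product Lebesgue measure on the cube (the per-piece leaves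
`NobleH2Step`, `NobleH35Step`, `NobleH4StepD75` bound `|∫ piece_i|` by monotonicity against an integrable majorant and never need it).  This module
proves it, for the atoms `lapAtomsAt d c_Φ α_Φ c_F α_F R_Φ R_F` of a simplified-form witness with summable remainders of finite absolute second
moment whose key quantities obey `KeyBounds r` on the cube off `{D̂ = 1}` (`NobleLaplacianBounds.keyBounds_and_split`), and `d ≥ 2n + 5`:

* MEASURABILITY (§1–§2): `sinFT`, `gradFT`, `lapFT` of summable families are continuous (uniformly convergent trigonometric series, as
  `continuous_cosFT`), hence every atom of `lapAtomsAt … k` is a measurable function of `k`, and so are the rational expressions `Ĝ`, `Ĥ₁, …, Ĥ₅`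
  ((3.52)–(3.56)) in them;
* DOMINATION (§3): under `KeyBounds r` (and `D̂^{sin} Ĉ ≤ 2`, which holds for `D̂^{sin}(k) ≤ (2/d)[1 − D̂(k)]`, `SrwIntegralTU.Dsin_le`) each
  `|Ĥ_i(k)| ≤ M_i · Ĉ(k)²` with `Ĉ = 1/[1 − D̂]` and an explicit constant `M_i = M_i(r)` — coarse versions of the Step-2…5 pointwise bounds
  `NobleLaplacianBounds.LapAtoms.KeyBounds.abs_H{2,3,4,5}_le` and of (3.52) for `Ĥ₁`, using only `Ĉ ≥ 1/2`, `|D̂| ≤ 1`, `D̂^{sin} Ĉ ≤ 2`; with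
  `|Ĝ| ≤ Γ₂′ Ĉ` ((3.47)) the piece is dominated by `M_i Γ₂′ⁿ · |D̂|^l |D̂^{(x)}| Ĉ^{n+2}`, integrable for `2(n+2)+1 ≤ d` (`integrable_srwK_integrand`,
  Heydenreich–van der Hofstad Prop. 5.5);
* INTEGRABILITY (§4): `Integrable.mono'`.

The constants `M_i` are for integrability only (no table entry depends on them).
[cite: FitznerVanDerHofstad2016NoBLE, §3.3.4 (3.44)–(3.47), (3.52)–(3.58), PTRF pp. 1072–1074; HeydenreichVanDerHofstad2017, Prop. 5.5]
-/

noncomputable section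

open MeasureTheory Real
open Literature.Barriers.CriticalPhenomena
open Literature.Barriers.CriticalPhenomena.Slade2006Prop53 (P)
open Literature.Probability.LatticeModels
open Literature.Probability.Percolation
open Literature.Probability.RandomPlanarGeometry.SAW.Zd (normSq)

namespace Literature.Probability.FitznerVanDerHofstad2017

variable {d : ℕ}

/-! ## §1 Continuity of the sine, gradient and Laplacian transforms of summable families -/

/-- `k ↦ Σ_x sin(k·x) f(x)` is continuous for summable `f` (uniformly convergent sine series). [folklore] -/
theorem continuous_sinFT {f : Site d → ℝ} (hf : Summable f) : Continuous (sinFT f) := by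
  have hk : ∀ x : Site d, Continuous fun k : Fin d → ℝ => kdot k x := fun x => by unfold kdot; fun_prop
  show Continuous fun k => ∑' x : Site d, Real.sin (kdot k x) * f x
  refine continuous_tsum (fun x => (Real.continuous_sin.comp (hk x)).mul continuous_const) hf.abs fun x k => ?_
  rw [Real.norm_eq_abs, abs_mul]
  exact mul_le_of_le_one_left (abs_nonneg _) (Real.abs_sin_le_one _)

/-- `∂̂`-transform `gradFT s f = sinFT (x_s f)` is continuous when `Σ|f|, Σ‖x‖²|f| < ∞`. [folklore] -/
theorem continuous_gradFT {f : Site d → ℝ} (hf : Summable f) (h2 : Summable (mulNormSq f)) (s : Fin d) :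
    Continuous (gradFT s f) := by
  show Continuous fun k => sinFT (mulCoord s f) k
  exact continuous_sinFT (summable_mulCoord hf h2 s)

/-- `−Δ̂`-transform `lapFT f = cosFT (‖x‖² f)` is continuous when `Σ‖x‖²|f| < ∞`. [folklore] -/
theorem continuous_lapFT {f : Site d → ℝ} (h2 : Summable (mulNormSq f)) : Continuous (lapFT f) := by
  show Continuous fun k => cosFT (mulNormSq f) k
  exact continuous_cosFT h2

/-! ## §2 Measurability of `Ĝ`, `Ĥ₁, …, Ĥ₅` along `k ↦ lapAtomsAt d c_Φ α_Φ c_F α_F R_Φ R_F k` -/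

section Measurable

variable {cΦ αΦ cF αF : ℝ} {RΦ RF : Site d → ℝ}

/-- The eight transform inputs of `lapAtomsAt` are measurable in `k`. [folklore] -/
theorem measurable_lapAtomsAt_inputs (hRΦ : Summable RΦ) (hRF : Summable RF)
    (hRΦ2 : Summable fun x => normSq x * |RΦ x|) (hRF2 : Summable fun x => normSq x * |RF x|) :
    Measurable (cosFT RΦ) ∧ Measurable (cosFT RF) ∧ Measurable (lapFT RΦ) ∧ Measurable (lapFT RF) ∧
      (∀ s, Measurable (gradFT s RΦ)) ∧ (∀ s, Measurable (gradFT s RF)) ∧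
      Measurable (Dhat d) ∧ Measurable (Dsin d) :=
  ⟨(continuous_cosFT hRΦ).measurable, (continuous_cosFT hRF).measurable,
    (continuous_lapFT (summable_mulNormSq_of_abs hRΦ2)).measurable,
    (continuous_lapFT (summable_mulNormSq_of_abs hRF2)).measurable,
    fun s => (continuous_gradFT hRΦ (summable_mulNormSq_of_abs hRΦ2) s).measurable,
    fun s => (continuous_gradFT hRF (summable_mulNormSq_of_abs hRF2) s).measurable,
    (continuous_Dhat d).measurable, (continuous_Dsin d).measurable⟩

/-- `k ↦ Ĝ(k)` on the atoms is measurable. [cite: FitznerVanDerHofstad2016NoBLE, §1.3 (1.37), PTRF p. 1050] -/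
theorem measurable_lapAtomsAt_G (hRΦ : Summable RΦ) (hRF : Summable RF)
    (hRΦ2 : Summable fun x => normSq x * |RΦ x|) (hRF2 : Summable fun x => normSq x * |RF x|) :
    Measurable fun k => (lapAtomsAt d cΦ αΦ cF αF RΦ RF k).G := by
  obtain ⟨h1, h2, h3, h4, h5, h6, hD, hS⟩ := measurable_lapAtomsAt_inputs (d := d) hRΦ hRF hRΦ2 hRF2
  simp only [lapAtomsAt, LapAtoms.G, LapAtoms.Phi]
  fun_prop

/-- `k ↦ Ĥ₁(k)` ((3.52)) on the atoms is measurable. [cite: FitznerVanDerHofstad2016NoBLE, §3.3.4 (3.52), PTRF p. 1073] -/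
theorem measurable_lapAtomsAt_H1 (hRΦ : Summable RΦ) (hRF : Summable RF)
    (hRΦ2 : Summable fun x => normSq x * |RΦ x|) (hRF2 : Summable fun x => normSq x * |RF x|) :
    Measurable fun k => (lapAtomsAt d cΦ αΦ cF αF RΦ RF k).H1 := by
  obtain ⟨h1, h2, h3, h4, h5, h6, hD, hS⟩ := measurable_lapAtomsAt_inputs (d := d) hRΦ hRF hRΦ2 hRF2
  simp only [lapAtomsAt, LapAtoms.H1, LapAtoms.Cstar, LapAtoms.Cden, LapAtoms.Mstar]
  fun_prop

/-- `k ↦ Ĥ₂(k)` ((3.53)) on the atoms is measurable. [cite: FitznerVanDerHofstad2016NoBLE, §3.3.4 (3.53), PTRF p. 1073] -/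
theorem measurable_lapAtomsAt_H2 (hRΦ : Summable RΦ) (hRF : Summable RF)
    (hRΦ2 : Summable fun x => normSq x * |RΦ x|) (hRF2 : Summable fun x => normSq x * |RF x|) :
    Measurable fun k => (lapAtomsAt d cΦ αΦ cF αF RΦ RF k).H2 := by
  obtain ⟨h1, h2, h3, h4, h5, h6, hD, hS⟩ := measurable_lapAtomsAt_inputs (d := d) hRΦ hRF hRΦ2 hRF2
  simp only [lapAtomsAt, LapAtoms.H2, LapAtoms.E, LapAtoms.Cstar, LapAtoms.Cden, LapAtoms.Mstar]
  fun_prop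

/-- `k ↦ Ĥ₃(k)` ((3.54)) on the atoms is measurable. [cite: FitznerVanDerHofstad2016NoBLE, §3.3.4 (3.54), PTRF p. 1073] -/
theorem measurable_lapAtomsAt_H3 (hRΦ : Summable RΦ) (hRF : Summable RF)
    (hRΦ2 : Summable fun x => normSq x * |RΦ x|) (hRF2 : Summable fun x => normSq x * |RF x|) :
    Measurable fun k => (lapAtomsAt d cΦ αΦ cF αF RΦ RF k).H3 := by
  obtain ⟨h1, h2, h3, h4, h5, h6, hD, hS⟩ := measurable_lapAtomsAt_inputs (d := d) hRΦ hRF hRΦ2 hRF2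
  simp only [lapAtomsAt, LapAtoms.H3, LapAtoms.E, LapAtoms.Cstar, LapAtoms.Cden, LapAtoms.G, LapAtoms.Phi]
  fun_prop

/-- `k ↦ Ĥ₄(k)` ((3.55)) on the atoms is measurable. [cite: FitznerVanDerHofstad2016NoBLE, §3.3.4 (3.55), PTRF p. 1073] -/
theorem measurable_lapAtomsAt_H4 (hRΦ : Summable RΦ) (hRF : Summable RF)
    (hRΦ2 : Summable fun x => normSq x * |RΦ x|) (hRF2 : Summable fun x => normSq x * |RF x|) :
    Measurable fun k => (lapAtomsAt d cΦ αΦ cF αF RΦ RF k).H4 := by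
  obtain ⟨h1, h2, h3, h4, h5, h6, hD, hS⟩ := measurable_lapAtomsAt_inputs (d := d) hRΦ hRF hRΦ2 hRF2
  simp only [lapAtomsAt, LapAtoms.H4, LapAtoms.G, LapAtoms.Phi]
  fun_prop

/-- `k ↦ Ĥ₅(k)` ((3.56)) on the atoms is measurable. [cite: FitznerVanDerHofstad2016NoBLE, §3.3.4 (3.56), PTRF p. 1073] -/
theorem measurable_lapAtomsAt_H5 (hRΦ : Summable RΦ) (hRF : Summable RF)
    (hRΦ2 : Summable fun x => normSq x * |RΦ x|) (hRF2 : Summable fun x => normSq x * |RF x|) :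
    Measurable fun k => (lapAtomsAt d cΦ αΦ cF αF RΦ RF k).H5 := by
  obtain ⟨h1, h2, h3, h4, h5, h6, hD, hS⟩ := measurable_lapAtomsAt_inputs (d := d) hRΦ hRF hRΦ2 hRF2
  simp only [lapAtomsAt, LapAtoms.H5, LapAtoms.G, LapAtoms.Phi]
  fun_prop

end Measurable

/-! ## §3 Coarse domination `|Ĥ_i| ≤ M_i Ĉ²` under the key-quantity bounds -/

namespace LapAtoms.KeyBounds

variable {a : LapAtoms} {r : F3Bounds.Args}

/-- `Ĉ = 1/[1 − D̂] ≥ 1/2` (as `1 ≤ 2Ĉ`) from `|D̂| ≤ 1`. [folklore] -/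
theorem one_le_two_mul_C (h : a.KeyBounds r) : 1 ≤ 2 * (1 / (1 - a.D)) := by
  have h1 : 1 - a.D ≤ 2 := by have := h.absD; rw [abs_le] at this; linarith [this.1]
  have h2 : 1 / 2 ≤ 1 / (1 - a.D) := one_div_le_one_div_of_le h.one_sub_D_pos h1
  linarith

/-- `Ĉ ≤ 2Ĉ²`. [folklore] -/
theorem C_le_two_mul_C_sq (h : a.KeyBounds r) : 1 / (1 - a.D) ≤ 2 * (1 / (1 - a.D)) ^ 2 := by
  have h0 := h.C_pos
  have h1 := h.one_le_two_mul_C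
  nlinarith [mul_nonneg h0.le (by linarith : (0 : ℝ) ≤ 2 * (1 / (1 - a.D)) - 1)]

/-- `|M̂*| ≤ 1 + 4/α̲_F` when `D̂^{sin} Ĉ ≤ 2`. [cite: FitznerVanDerHofstad2016NoBLE, §3.3.4 (3.45) and (3.69), PTRF pp. 1072, 1076] -/
theorem abs_Mstar_le_const (h : a.KeyBounds r) (hDs : a.Dsin * (1 / (1 - a.D)) ≤ 2) :
    |a.Mstar| ≤ 1 + 4 / r.afmin := by
  have hM := h.abs_Mstar_le'
  have hD := h.absD
  have haf := h.afmin_pos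
  have e : 2 * a.Dsin * (1 / (1 - a.D) / r.afmin) = 2 / r.afmin * (a.Dsin * (1 / (1 - a.D))) := by ring
  rw [e] at hM
  have t : 2 / r.afmin * (a.Dsin * (1 / (1 - a.D))) ≤ 2 / r.afmin * 2 :=
    mul_le_mul_of_nonneg_left hDs (div_nonneg (by norm_num) haf.le)
  calc |a.Mstar| ≤ |a.D| + 2 / r.afmin * (a.Dsin * (1 / (1 - a.D))) := hM
    _ ≤ 1 + 2 / r.afmin * 2 := add_le_add hD t
    _ = 1 + 4 / r.afmin := by ring

/-- Coarse Step 1: `|Ĥ₁| ≤ M₁ Ĉ²`, `M₁ = (ᾱ_F (c̄_Φ + β_{α,Φ})/α̲_F + 2β_{α,Φ})/α̲_F · (1 + 4/α̲_F)`.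
[cite: FitznerVanDerHofstad2016NoBLE, §3.3.4 (3.52) with (3.46)–(3.47), PTRF pp. 1072–1073] -/
theorem abs_H1_le_sq (h : a.KeyBounds r) (hDs : a.Dsin * (1 / (1 - a.D)) ≤ 2) :
    |a.H1| ≤ (r.afmax * (r.cp + r.ap) / r.afmin + 2 * r.ap) / r.afmin * (1 + 4 / r.afmin) * (1 / (1 - a.D)) ^ 2 := by
  have hC := h.Cstar_pos
  have hCle := h.Cstar_le
  have hαF := h.αF_pos
  have hαFle := h.αF_le
  have hcΦ := h.abs_cΦ_add_le
  have hαΦ := h.αΦ_abs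
  have hap := h.ap_nn
  have hcp := h.cp_nn
  have hD := h.absD
  have haf := h.afmin_pos
  have hM := h.abs_Mstar_le_const hDs
  have h12 := h.one_le_two_mul_C
  have hX0 := h.C_pos
  set X := 1 / (1 - a.D) with hXdef
  have hafmax : 0 ≤ r.afmax := hαF.le.trans hαFle
  have hcΦ' : |a.cΦ + a.αΦ * a.D| ≤ r.cp + r.ap := by nlinarith [mul_nonneg hap (sub_nonneg.2 hD)]
  have hin : |a.αF * (a.cΦ + a.αΦ * a.D) * a.Cstar + a.αΦ| ≤ (r.afmax * (r.cp + r.ap) / r.afmin + 2 * r.ap) * X := by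
    calc |a.αF * (a.cΦ + a.αΦ * a.D) * a.Cstar + a.αΦ|
        ≤ |a.αF * (a.cΦ + a.αΦ * a.D) * a.Cstar| + |a.αΦ| := abs_add_le _ _
      _ = a.αF * |a.cΦ + a.αΦ * a.D| * a.Cstar + |a.αΦ| := by
          rw [abs_mul, abs_mul, abs_of_pos hαF, abs_of_pos hC]
      _ ≤ r.afmax * (r.cp + r.ap) * (X / r.afmin) + r.ap * (2 * X) := by
          refine add_le_add ?_ ?_
          · exact mul_le_mul (mul_le_mul hαFle hcΦ' (abs_nonneg _) hafmax) hCle hC.le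
              (mul_nonneg hafmax (add_nonneg hcp hap))
          · nlinarith
      _ = (r.afmax * (r.cp + r.ap) / r.afmin + 2 * r.ap) * X := by ring
  have hin0 : 0 ≤ (r.afmax * (r.cp + r.ap) / r.afmin + 2 * r.ap) * X := (abs_nonneg _).trans hin
  rw [LapAtoms.H1, abs_mul, abs_mul, abs_of_pos hC]
  calc |a.αF * (a.cΦ + a.αΦ * a.D) * a.Cstar + a.αΦ| * a.Cstar * |a.Mstar|
      ≤ (r.afmax * (r.cp + r.ap) / r.afmin + 2 * r.ap) * X * (X / r.afmin) * (1 + 4 / r.afmin) :=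
        mul_le_mul (mul_le_mul hin hCle hC.le hin0) hM (abs_nonneg _)
          (mul_nonneg hin0 (div_nonneg hX0.le haf.le))
    _ = (r.afmax * (r.cp + r.ap) / r.afmin + 2 * r.ap) / r.afmin * (1 + 4 / r.afmin) * X ^ 2 := by ring

/-- Coarse Step 2: `|Ĥ₂| ≤ M₂ Ĉ²`,
`M₂ = (β_{|ΔR,F|} K̲ ((c̄_Φ + β_{α,Φ})(1/α̲_F + K̲) + 2β_{α,Φ}/α̲_F) + ᾱ_F β_{R,Φ} K̲²)(1 + 4/α̲_F)`.
[cite: FitznerVanDerHofstad2016NoBLE, §3.3.5 Step 2 (3.70)–(3.71), PTRF p. 1076] -/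
theorem abs_H2_le_sq (h : a.KeyBounds r) (hDs : a.Dsin * (1 / (1 - a.D)) ≤ 2) :
    |a.H2| ≤ (r.bRfDelta * r.Kunderline * ((r.cp + r.ap) * (1 / r.afmin + r.Kunderline) + 2 * r.ap / r.afmin) +
      r.afmax * r.bRp * r.Kunderline ^ 2) * (1 + 4 / r.afmin) * (1 / (1 - a.D)) ^ 2 := by
  have h2 := h.abs_H2_le
  have hM := h.abs_Mstar_le_const hDs
  have hX2 := h.C_le_two_mul_C_sq
  have hX0 := h.C_pos
  have hD := h.absD
  have hap := h.ap_nn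
  have hcp := h.cp_nn
  have haf := h.afmin_pos
  have hK := h.K_nn
  have hβ := h.bRfDelta_nn
  have hbRp := h.bRp_nn
  have hafmax : 0 ≤ r.afmax := h.αF_pos.le.trans h.αF_le
  set X := 1 / (1 - a.D) with hXdef
  have hq : 0 ≤ 1 / r.afmin + r.Kunderline := add_nonneg (div_nonneg zero_le_one haf.le) hK
  have t1 : (r.cp + r.ap * |a.D|) * (1 / r.afmin + r.Kunderline) * X ^ 2 ≤
      (r.cp + r.ap) * (1 / r.afmin + r.Kunderline) * X ^ 2 :=
    mul_le_mul_of_nonneg_right (mul_le_mul_of_nonneg_right (by nlinarith [mul_nonneg hap (sub_nonneg.2 hD)]) hq)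
      (pow_nonneg hX0.le 2)
  have t2 : r.ap / r.afmin * X ≤ r.ap / r.afmin * (2 * X ^ 2) :=
    mul_le_mul_of_nonneg_left hX2 (div_nonneg hap haf.le)
  have hB : (r.cp + r.ap * |a.D|) * (1 / r.afmin + r.Kunderline) * X ^ 2 + r.ap / r.afmin * X ≤
      ((r.cp + r.ap) * (1 / r.afmin + r.Kunderline) + 2 * r.ap / r.afmin) * X ^ 2 := by
    have e : ((r.cp + r.ap) * (1 / r.afmin + r.Kunderline) + 2 * r.ap / r.afmin) * X ^ 2 =
        (r.cp + r.ap) * (1 / r.afmin + r.Kunderline) * X ^ 2 + r.ap / r.afmin * (2 * X ^ 2) := by ring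
    rw [e]; exact add_le_add t1 t2
  have hB'0 : 0 ≤ ((r.cp + r.ap) * (1 / r.afmin + r.Kunderline) + 2 * r.ap / r.afmin) * X ^ 2 :=
    mul_nonneg (add_nonneg (mul_nonneg (add_nonneg hcp hap) hq)
      (div_nonneg (mul_nonneg (by norm_num) hap) haf.le)) (pow_nonneg hX0.le 2)
  have s1 : r.bRfDelta * r.Kunderline *
        ((r.cp + r.ap * |a.D|) * (1 / r.afmin + r.Kunderline) * X ^ 2 + r.ap / r.afmin * X) * |a.Mstar| ≤
      r.bRfDelta * r.Kunderline *
        (((r.cp + r.ap) * (1 / r.afmin + r.Kunderline) + 2 * r.ap / r.afmin) * X ^ 2) * (1 + 4 / r.afmin) :=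
    mul_le_mul (mul_le_mul_of_nonneg_left hB (mul_nonneg hβ hK)) hM (abs_nonneg _)
      (mul_nonneg (mul_nonneg hβ hK) hB'0)
  have s2 : r.afmax * r.bRp * r.Kunderline ^ 2 * X ^ 2 * |a.Mstar| ≤
      r.afmax * r.bRp * r.Kunderline ^ 2 * X ^ 2 * (1 + 4 / r.afmin) :=
    mul_le_mul_of_nonneg_left hM
      (mul_nonneg (mul_nonneg (mul_nonneg hafmax hbRp) (sq_nonneg _)) (pow_nonneg hX0.le 2))
  calc |a.H2| ≤ _ := h2
    _ ≤ r.bRfDelta * r.Kunderline *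
          (((r.cp + r.ap) * (1 / r.afmin + r.Kunderline) + 2 * r.ap / r.afmin) * X ^ 2) * (1 + 4 / r.afmin) +
        r.afmax * r.bRp * r.Kunderline ^ 2 * X ^ 2 * (1 + 4 / r.afmin) := add_le_add s1 s2
    _ = _ := by ring

/-- Coarse Step 3: `|Ĥ₃| ≤ M₃ Ĉ²`, `M₃ = 8K̲² β_{α,Φ}(β_{|ΔR,F|}/α̲_F + m₃) + 4K̲² Γ₂′ (ᾱ_F m₃ + β_{|ΔR,F|})`.
[cite: FitznerVanDerHofstad2016NoBLE, §3.3.5 Step 3 (3.75)–(3.76), PTRF p. 1077] -/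
theorem abs_H3_le_sq (h : a.KeyBounds r) (hDs : a.Dsin * (1 / (1 - a.D)) ≤ 2) :
    |a.H3| ≤ (8 * r.Kunderline ^ 2 * r.ap * (r.bRfDelta / r.afmin + F3Bounds.m3 r) +
      4 * r.Kunderline ^ 2 * r.Gamma2dash * (r.afmax * F3Bounds.m3 r + r.bRfDelta)) * (1 / (1 - a.D)) ^ 2 := by
  have h3 := h.abs_H3_le
  have hX2 := h.C_le_two_mul_C_sq
  have hX0 := h.C_pos
  have hap := h.ap_nn
  have haf := h.afmin_pos
  have hK := h.K_nn
  have hβ := h.bRfDelta_nn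
  have hΓ := h.Gamma2dash_nn
  have hm3 : 0 ≤ F3Bounds.m3 r := (abs_nonneg _).trans h.abs_αF_sub_one_le
  have hafmax : 0 ≤ r.afmax := h.αF_pos.le.trans h.αF_le
  have hDs0 := h.Dsin_nn
  set X := 1 / (1 - a.D) with hXdef
  have hD2 : a.Dsin * X ^ 2 ≤ 4 * X ^ 2 := by
    have : a.Dsin * X ^ 2 = a.Dsin * X * X := by ring
    rw [this]
    calc a.Dsin * X * X ≤ 2 * X := mul_le_mul_of_nonneg_right hDs hX0.le
      _ ≤ 2 * (2 * X ^ 2) := by linarith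
      _ = 4 * X ^ 2 := by ring
  have hD3 : a.Dsin * X ^ 3 ≤ 2 * X ^ 2 := by
    have : a.Dsin * X ^ 3 = a.Dsin * X * X ^ 2 := by ring
    rw [this]
    exact mul_le_mul_of_nonneg_right hDs (pow_nonneg hX0.le 2)
  have hc1 : 0 ≤ 2 * r.Kunderline ^ 2 * r.ap * (r.bRfDelta / r.afmin + F3Bounds.m3 r) :=
    mul_nonneg (mul_nonneg (mul_nonneg (by norm_num) (sq_nonneg _)) hap) (add_nonneg (div_nonneg hβ haf.le) hm3)
  have hc2 : 0 ≤ 2 * r.Kunderline ^ 2 * r.Gamma2dash * (r.afmax * F3Bounds.m3 r + r.bRfDelta) :=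
    mul_nonneg (mul_nonneg (mul_nonneg (by norm_num) (sq_nonneg _)) hΓ) (add_nonneg (mul_nonneg hafmax hm3) hβ)
  have s1 := mul_le_mul_of_nonneg_left hD2 hc1
  have s2 := mul_le_mul_of_nonneg_left hD3 hc2
  calc |a.H3| ≤ _ := h3
    _ ≤ 2 * r.Kunderline ^ 2 * r.ap * (r.bRfDelta / r.afmin + F3Bounds.m3 r) * (4 * X ^ 2) +
        2 * r.Kunderline ^ 2 * r.Gamma2dash * (r.afmax * F3Bounds.m3 r + r.bRfDelta) * (2 * X ^ 2) := add_le_add s1 s2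
    _ = _ := by ring

/-- Coarse Step 4: `|Ĥ₄| ≤ M₄ Ĉ²`, `M₄ = K̲ (2β_{ΔR,Φ} + β_{|ΔR,F|} Γ₂′)`.
[cite: FitznerVanDerHofstad2016NoBLE, §3.3.5 Step 4 (3.78), PTRF p. 1077] -/
theorem abs_H4_le_sq (h : a.KeyBounds r) :
    |a.H4| ≤ r.Kunderline * (2 * r.bRpDelta + r.bRfDelta * r.Gamma2dash) * (1 / (1 - a.D)) ^ 2 := by
  have h4 := h.abs_H4_le
  have hX2 := h.C_le_two_mul_C_sq
  have hK := h.K_nn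
  have hβ := h.bRpDelta_nn
  set X := 1 / (1 - a.D) with hXdef
  have s1 : r.bRpDelta * X ≤ r.bRpDelta * (2 * X ^ 2) := mul_le_mul_of_nonneg_left hX2 hβ
  calc |a.H4| ≤ _ := h4
    _ ≤ r.Kunderline * (r.bRpDelta * (2 * X ^ 2) + r.bRfDelta * r.Gamma2dash * X ^ 2) :=
        mul_le_mul_of_nonneg_left (by linarith) hK
    _ = _ := by ring

/-- Coarse Step 5: `|Ĥ₅| ≤ M₅ Ĉ²`, `M₅ = 4K̲² Γ₂′ (2ᾱ_F β_{|ΔR,F|} + β_{|ΔR,F|}²) + 8K̲² (ᾱ_F β_{ΔR,Φ} + (β_{α,Φ} + β_{ΔR,Φ}) β_{|ΔR,F|})`.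
[cite: FitznerVanDerHofstad2016NoBLE, §3.3.5 Step 5 (3.81)–(3.85), PTRF pp. 1078–1079] -/
theorem abs_H5_le_sq (h : a.KeyBounds r) (hDs : a.Dsin * (1 / (1 - a.D)) ≤ 2) :
    |a.H5| ≤ (4 * r.Kunderline ^ 2 * r.Gamma2dash * (2 * r.afmax * r.bRfDelta + r.bRfDelta ^ 2) +
      8 * r.Kunderline ^ 2 * (r.afmax * r.bRpDelta + (r.ap + r.bRpDelta) * r.bRfDelta)) * (1 / (1 - a.D)) ^ 2 := by
  have h5 := h.abs_H5_le
  have hX2 := h.C_le_two_mul_C_sq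
  have hX0 := h.C_pos
  have hap := h.ap_nn
  have hK := h.K_nn
  have hβ := h.bRfDelta_nn
  have hβ' := h.bRpDelta_nn
  have hΓ := h.Gamma2dash_nn
  have hafmax : 0 ≤ r.afmax := h.αF_pos.le.trans h.αF_le
  set X := 1 / (1 - a.D) with hXdef
  have hD2 : a.Dsin * X ^ 2 ≤ 4 * X ^ 2 := by
    have : a.Dsin * X ^ 2 = a.Dsin * X * X := by ring
    rw [this]
    calc a.Dsin * X * X ≤ 2 * X := mul_le_mul_of_nonneg_right hDs hX0.le
      _ ≤ 2 * (2 * X ^ 2) := by linarith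
      _ = 4 * X ^ 2 := by ring
  have hD3 : a.Dsin * X ^ 3 ≤ 2 * X ^ 2 := by
    have : a.Dsin * X ^ 3 = a.Dsin * X * X ^ 2 := by ring
    rw [this]
    exact mul_le_mul_of_nonneg_right hDs (pow_nonneg hX0.le 2)
  have hc1 : 0 ≤ 2 * r.Kunderline ^ 2 * r.Gamma2dash * (2 * r.afmax * r.bRfDelta + r.bRfDelta ^ 2) :=
    mul_nonneg (mul_nonneg (mul_nonneg (by norm_num) (sq_nonneg _)) hΓ)
      (add_nonneg (mul_nonneg (mul_nonneg (by norm_num) hafmax) hβ) (sq_nonneg _))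
  have hc2 : 0 ≤ 2 * r.Kunderline ^ 2 * (r.afmax * r.bRpDelta + (r.ap + r.bRpDelta) * r.bRfDelta) :=
    mul_nonneg (mul_nonneg (by norm_num) (sq_nonneg _))
      (add_nonneg (mul_nonneg hafmax hβ') (mul_nonneg (add_nonneg hap hβ') hβ))
  have s1 := mul_le_mul_of_nonneg_left hD3 hc1
  have s2 := mul_le_mul_of_nonneg_left hD2 hc2
  calc |a.H5| ≤ _ := h5
    _ ≤ 2 * r.Kunderline ^ 2 * r.Gamma2dash * (2 * r.afmax * r.bRfDelta + r.bRfDelta ^ 2) * (2 * X ^ 2) +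
        2 * r.Kunderline ^ 2 * (r.afmax * r.bRpDelta + (r.ap + r.bRpDelta) * r.bRfDelta) * (4 * X ^ 2) :=
      add_le_add s1 s2
    _ = _ := by ring

/-- The piece majorant: `|Ĥ_i| ≤ M Ĉ²` and `|Ĝ| ≤ Γ₂′ Ĉ` give `|Ĥ_i Ĝⁿ w| ≤ M Γ₂′ⁿ (|w| Ĉ^{n+2})`.
[cite: FitznerVanDerHofstad2016NoBLE, §3.3.4 (3.47) and §3.3.5 (3.58), PTRF pp. 1072–1074] -/
theorem abs_piece_le (h : a.KeyBounds r) {H M : ℝ} (hH : |H| ≤ M * (1 / (1 - a.D)) ^ 2) (n : ℕ) (w : ℝ) :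
    |H * a.G ^ n * w| ≤ M * r.Gamma2dash ^ n * (|w| * (1 / (1 - a.D)) ^ (n + 2)) := by
  have hG := pow_le_pow_left₀ (abs_nonneg _) h.abs_G_le n
  have hM0 : 0 ≤ M * (1 / (1 - a.D)) ^ 2 := (abs_nonneg _).trans hH
  rw [abs_mul, abs_mul, abs_pow]
  calc |H| * |a.G| ^ n * |w| ≤ M * (1 / (1 - a.D)) ^ 2 * (r.Gamma2dash * (1 / (1 - a.D))) ^ n * |w| :=
        mul_le_mul_of_nonneg_right (mul_le_mul hH hG (pow_nonneg (abs_nonneg _) n) hM0) (abs_nonneg w)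
    _ = M * r.Gamma2dash ^ n * (|w| * (1 / (1 - a.D)) ^ (n + 2)) := by rw [mul_pow]; ring

end LapAtoms.KeyBounds

/-! ## §4 Integrability of the five pieces -/

/-- `D̂^{sin}(k) Ĉ(k) ≤ 2/d ≤ 2` off `{D̂ = 1}` (from `D̂^{sin} ≤ (2/d)[1 − D̂]`). [cite: FitznerVanDerHofstad2016NoBLE, §3.3.5 (3.68), PTRF p. 1076] -/
theorem Dsin_mul_inv_oneSubDhat_le_two (hd : 1 ≤ d) {k : Fin d → ℝ} (hk : Dhat d k < 1) :
    Dsin d k * (1 / (1 - Dhat d k)) ≤ 2 := by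
  have h1 : 0 < 1 - Dhat d k := sub_pos.2 hk
  have hd' : (1 : ℝ) ≤ d := by exact_mod_cast hd
  calc Dsin d k * (1 / (1 - Dhat d k)) ≤ 2 / d * (1 - Dhat d k) * (1 / (1 - Dhat d k)) :=
        mul_le_mul_of_nonneg_right (Dsin_le hd k) (one_div_pos.2 h1).le
    _ = 2 / d := by field_simp
    _ ≤ 2 := div_le_self (by norm_num) hd'

section Integrable

variable {cΦ αΦ cF αF : ℝ} {RΦ RF : Site d → ℝ} {r : F3Bounds.Args}

/-- Master lemma: a measurable `H` with `|H(k)| ≤ M Ĉ(k)²` on the cube off `{D̂ = 1}` gives an integrable piece `H Ĝⁿ D̂^l D̂^{(x)}` for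
`2(n+2)+1 ≤ d` (dominated by `M Γ₂′ⁿ |D̂|^l |D̂^{(x)}| Ĉ^{n+2}`, `integrable_srwK_integrand`). [cite: HeydenreichVanDerHofstad2017, Prop. 5.5] -/
theorem integrable_piece_of_abs_le_sq {n : ℕ} (hd : 2 * (n + 2) + 1 ≤ d)
    (hRΦ : Summable RΦ) (hRF : Summable RF) (hRΦ2 : Summable fun x => normSq x * |RΦ x|)
    (hRF2 : Summable fun x => normSq x * |RF x|)
    (hKB : ∀ k ∈ cube d, Dhat d k < 1 → (lapAtomsAt d cΦ αΦ cF αF RΦ RF k).KeyBounds r)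
    {H : (Fin d → ℝ) → ℝ} (hHm : Measurable H) {M : ℝ}
    (hle : ∀ k ∈ cube d, Dhat d k < 1 → |H k| ≤ M * (1 / (1 - Dhat d k)) ^ 2) (l : ℕ) (x : Site d) :
    Integrable (fun k => H k * (lapAtomsAt d cΦ αΦ cF αF RΦ RF k).G ^ n * Dhat d k ^ l * DhatSym d x k) (P d) := by
  have hI := (integrable_srwK_integrand (d := d) (n := n + 2) hd l x).const_mul (M * r.Gamma2dash ^ n)
  refine hI.mono' ?_ ?_
  · exact (((hHm.mul ((measurable_lapAtomsAt_G hRΦ hRF hRΦ2 hRF2).pow_const n)).mul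
      ((continuous_Dhat d).measurable.pow_const l)).mul (measurable_DhatSym d x)).aestronglyMeasurable
  · filter_upwards [ae_mem_cube_and_Dhat_lt_one (d := d) (by omega)] with k hk
    have h := hKB k hk.1 hk.2
    have hX : 1 / (1 - (lapAtomsAt d cΦ αΦ cF αF RΦ RF k).D) = Chat d 1 k := by rw [lapAtomsAt_D, Chat, one_mul]
    have hle' : |H k| ≤ M * (1 / (1 - (lapAtomsAt d cΦ αΦ cF αF RΦ RF k).D)) ^ 2 := by
      rw [lapAtomsAt_D]; exact hle k hk.1 hk.2
    have hb := h.abs_piece_le hle' n (Dhat d k ^ l * DhatSym d x k)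
    rw [hX] at hb
    rw [Real.norm_eq_abs]
    calc |H k * (lapAtomsAt d cΦ αΦ cF αF RΦ RF k).G ^ n * Dhat d k ^ l * DhatSym d x k|
        = |H k * (lapAtomsAt d cΦ αΦ cF αF RΦ RF k).G ^ n * (Dhat d k ^ l * DhatSym d x k)| := by rw [mul_assoc]
      _ ≤ M * r.Gamma2dash ^ n * (|Dhat d k ^ l * DhatSym d x k| * Chat d 1 k ^ (n + 2)) := hb
      _ = M * r.Gamma2dash ^ n * (|Dhat d k| ^ l * |DhatSym d x k| * Chat d 1 k ^ (n + 2)) := by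
          rw [abs_mul, abs_pow]

/-- **Piece 1 is integrable.** [cite: FitznerVanDerHofstad2016NoBLE, §3.3.4 (3.52) and §3.3.5 (3.58), PTRF pp. 1073–1074] -/
theorem integrable_piece_H1 {n : ℕ} (hd : 2 * (n + 2) + 1 ≤ d)
    (hRΦ : Summable RΦ) (hRF : Summable RF) (hRΦ2 : Summable fun x => normSq x * |RΦ x|)
    (hRF2 : Summable fun x => normSq x * |RF x|)
    (hKB : ∀ k ∈ cube d, Dhat d k < 1 → (lapAtomsAt d cΦ αΦ cF αF RΦ RF k).KeyBounds r) (l : ℕ) (x : Site d) :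
    Integrable (fun k => (lapAtomsAt d cΦ αΦ cF αF RΦ RF k).H1 * (lapAtomsAt d cΦ αΦ cF αF RΦ RF k).G ^ n *
      Dhat d k ^ l * DhatSym d x k) (P d) :=
  integrable_piece_of_abs_le_sq hd hRΦ hRF hRΦ2 hRF2 hKB (measurable_lapAtomsAt_H1 hRΦ hRF hRΦ2 hRF2)
    (fun k hk hk1 => (hKB k hk hk1).abs_H1_le_sq (Dsin_mul_inv_oneSubDhat_le_two (by omega) hk1)) l x

/-- **Piece 2 is integrable.** [cite: FitznerVanDerHofstad2016NoBLE, §3.3.4 (3.53) and §3.3.5 (3.58), PTRF pp. 1073–1074] -/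
theorem integrable_piece_H2 {n : ℕ} (hd : 2 * (n + 2) + 1 ≤ d)
    (hRΦ : Summable RΦ) (hRF : Summable RF) (hRΦ2 : Summable fun x => normSq x * |RΦ x|)
    (hRF2 : Summable fun x => normSq x * |RF x|)
    (hKB : ∀ k ∈ cube d, Dhat d k < 1 → (lapAtomsAt d cΦ αΦ cF αF RΦ RF k).KeyBounds r) (l : ℕ) (x : Site d) :
    Integrable (fun k => (lapAtomsAt d cΦ αΦ cF αF RΦ RF k).H2 * (lapAtomsAt d cΦ αΦ cF αF RΦ RF k).G ^ n *
      Dhat d k ^ l * DhatSym d x k) (P d) :=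
  integrable_piece_of_abs_le_sq hd hRΦ hRF hRΦ2 hRF2 hKB (measurable_lapAtomsAt_H2 hRΦ hRF hRΦ2 hRF2)
    (fun k hk hk1 => (hKB k hk hk1).abs_H2_le_sq (Dsin_mul_inv_oneSubDhat_le_two (by omega) hk1)) l x

/-- **Piece 3 is integrable.** [cite: FitznerVanDerHofstad2016NoBLE, §3.3.4 (3.54) and §3.3.5 (3.58), PTRF pp. 1073–1074] -/
theorem integrable_piece_H3 {n : ℕ} (hd : 2 * (n + 2) + 1 ≤ d)
    (hRΦ : Summable RΦ) (hRF : Summable RF) (hRΦ2 : Summable fun x => normSq x * |RΦ x|)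
    (hRF2 : Summable fun x => normSq x * |RF x|)
    (hKB : ∀ k ∈ cube d, Dhat d k < 1 → (lapAtomsAt d cΦ αΦ cF αF RΦ RF k).KeyBounds r) (l : ℕ) (x : Site d) :
    Integrable (fun k => (lapAtomsAt d cΦ αΦ cF αF RΦ RF k).H3 * (lapAtomsAt d cΦ αΦ cF αF RΦ RF k).G ^ n *
      Dhat d k ^ l * DhatSym d x k) (P d) :=
  integrable_piece_of_abs_le_sq hd hRΦ hRF hRΦ2 hRF2 hKB (measurable_lapAtomsAt_H3 hRΦ hRF hRΦ2 hRF2)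
    (fun k hk hk1 => (hKB k hk hk1).abs_H3_le_sq (Dsin_mul_inv_oneSubDhat_le_two (by omega) hk1)) l x

/-- **Piece 4 is integrable.** [cite: FitznerVanDerHofstad2016NoBLE, §3.3.4 (3.55) and §3.3.5 (3.58), PTRF pp. 1073–1074] -/
theorem integrable_piece_H4 {n : ℕ} (hd : 2 * (n + 2) + 1 ≤ d)
    (hRΦ : Summable RΦ) (hRF : Summable RF) (hRΦ2 : Summable fun x => normSq x * |RΦ x|)
    (hRF2 : Summable fun x => normSq x * |RF x|)
    (hKB : ∀ k ∈ cube d, Dhat d k < 1 → (lapAtomsAt d cΦ αΦ cF αF RΦ RF k).KeyBounds r) (l : ℕ) (x : Site d) :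
    Integrable (fun k => (lapAtomsAt d cΦ αΦ cF αF RΦ RF k).H4 * (lapAtomsAt d cΦ αΦ cF αF RΦ RF k).G ^ n *
      Dhat d k ^ l * DhatSym d x k) (P d) :=
  integrable_piece_of_abs_le_sq hd hRΦ hRF hRΦ2 hRF2 hKB (measurable_lapAtomsAt_H4 hRΦ hRF hRΦ2 hRF2)
    (fun k hk hk1 => (hKB k hk hk1).abs_H4_le_sq) l x

/-- **Piece 5 is integrable.** [cite: FitznerVanDerHofstad2016NoBLE, §3.3.4 (3.56) and §3.3.5 (3.58), PTRF pp. 1073–1074] -/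
theorem integrable_piece_H5 {n : ℕ} (hd : 2 * (n + 2) + 1 ≤ d)
    (hRΦ : Summable RΦ) (hRF : Summable RF) (hRΦ2 : Summable fun x => normSq x * |RΦ x|)
    (hRF2 : Summable fun x => normSq x * |RF x|)
    (hKB : ∀ k ∈ cube d, Dhat d k < 1 → (lapAtomsAt d cΦ αΦ cF αF RΦ RF k).KeyBounds r) (l : ℕ) (x : Site d) :
    Integrable (fun k => (lapAtomsAt d cΦ αΦ cF αF RΦ RF k).H5 * (lapAtomsAt d cΦ αΦ cF αF RΦ RF k).G ^ n *
      Dhat d k ^ l * DhatSym d x k) (P d) :=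
  integrable_piece_of_abs_le_sq hd hRΦ hRF hRΦ2 hRF2 hKB (measurable_lapAtomsAt_H5 hRΦ hRF hRΦ2 hRF2)
    (fun k hk hk1 => (hKB k hk hk1).abs_H5_le_sq (Dsin_mul_inv_oneSubDhat_le_two (by omega) hk1)) l x

end Integrable

end Literature.Probability.FitznerVanDerHofstad2017

end
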